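import Mathlib
import Literature.MathematicalPhysics.QuantumFieldTheory.Balaban1983to89.B6Lemma21Counterexample
import Literature.MathematicalPhysics.QuantumFieldTheory.Balaban1983to89.B6Lemma21Repaired

/-!
# `Balaban1983to89.B6Lemma21TwoScale` — the per-point count of B6 (2.58) is a TWO-SCALE count: the printed
`c₀(½α)^d` per intermediate surface point is exceeded (kernel witness, d = 4), the correct count `c₀(½α)^{2d}` is
kernel-proved (counting lemma), and Lemma 2.1 survives with `c₁″(α) = 13 c₀(½α)^{4d}` under the SAME (2.59)

CITATION HEADER (lean-in-tree rule 2026-08-18). Source: T. Bałaban, *Propagators and renormalization transformations for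
lattice gauge theories. II*, Comm. Math. Phys. **96**, 223–250 (1984) [Balaban1984PropagatorsII] (cell paper B6; PDF
`paper:balaban1984-cmp96-propagators-rt-ii`, journal page = PDF page + 222; renders
`b2b-balaban-ref1/pages/1984-cmp96-propagators-rt-II/…-p002/p009/p010/p011/p012-x2.png` = pp. 224, 231–234).
Adversarial reader 1, gen 8 (GAPS G-A13-1, C-A13-1). This module is a reproduction/audit of a PUBLISHED proof step;
nothing here is a claim about the summit.

THE STEP UNDER AUDIT (p. 233, (2.58)). The proof of Lemma 2.1 decomposes the optimal admissible contour Γ_{y,y′} into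
legs y → y₁ → y′₁ → y₂ → … → y′_m → y′ (p. 231, (2.47)) and bounds Σ_{y′∈𝔅} e^{−αδ₀d(y,y′)} by summing
e^{−½αδ₀·(weight)} over ALL intermediate points, «scaled to unit lattice», with the count
`(c₀(½α))^{d(2m+1)}` — i.e. ONE free ℤ^d variable per intermediate point, c₀(a) = Σ_{z∈ℤ} e^{−a|z|}.
FACT (from (2.46) and «|Γ| = nη», p. 231): d(y,y′) is the NUMBER OF ADMISSIBLE BONDS of the contour, every bond of
every lattice Λ_j weighing exactly 1 ((L^jη)^{−1}·L^jη). FACT (p. 231, ll. 20–27): the leg y_l → y′_l between the FIRST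
and the LAST intersection with the surface Σ_{j_l} is a concatenation of sub-portions lying alternately in
B^{j_l}(Λ_{j_l}) (coarse bonds, length L^{j_l}η) and B^{j_l−1}(Λ_{j_l−1}) (fine bonds, length L^{j_l−1}η), each
returning to Σ_{j_l}. Hence the endpoint y′_l of a leg of weight w is `y_l + L^{j_l}η·c + L^{j_l−1}η·f` with
c, f ∈ ℤ^d, |c|₁ + |f|₁ ≤ w — a TWO-SCALE displacement — and the row sum over y′_l of e^{−½αδ₀ w} is bounded by
`c₀(½α)^{2d}` (`sum_exp_le_c0_pow` with n = 2d, `twoScale_row_sum`), NOT by `c₀(½α)^d`: the printed count would need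
the fine offsets f to be absent (all surface points L^{j_l}η-sites), which the paper's own decomposition contradicts.
The legs y → y₁ and y′_l → y_{l+1} are single-scale by construction (contained in one B^{j}(Λ_j)), count `c₀(½α)^d`
(`singleScale_row_sum`).

WHAT IS REPRODUCED (kernel-checked, no `sorry`):
* `sum_exp_le_c0_pow` — COUNTING LEMMA: a finite set of points mapped injectively into ℤⁿ, with weights dominating the
  ℓ¹-size of the image, has row sum Σ e^{−αδ₀·w} ≤ c₀(δ₀,α)ⁿ; corollaries `singleScale_row_sum` (n = d) and
  `twoScale_row_sum` (n = 2d).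
* WITNESS that `c₀(½α)^d` per surface point is FALSE in d = 4 (a = ½αδ₀ = 1/16, L ≥ 32): `surfaceWitness_le_sum` +
  `surfaceWitness_gt`: for a coarse site y on a flat face of Σ_j, the 31⁶ distinct surface points y + L·c + f
  (c, f ∈ [−15,15]³ in the face, fine units, L ≥ 32 so the map is injective) are reached by admissible legs of
  ≤ |c|₁ + |f|₁ + 4 bonds (one coarse bond into Ω_j∖Ω_{j+1}, |c|₁ coarse bonds parallel to the face, one back to a coarse
  site of Σ_j, one fine bond out into Ω_{j−1}∖Ω_j, |f|₁ fine bonds parallel to the face, one back to Σ_j — all admissible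
  by the bond convention of p. 224, «at least one end-point of b belongs to Ω», and by (2.2) which gives ≥ RM cubes of
  room on both sides), so `Σ_{y′∈Σ_j} e^{−a·d̃(y,y′)} ≥ surfaceWitness a = e^{−4a}·(Σ_{|z|≤15}e^{−a|z|})⁶ ≥ 0.77·12⁶
  = 2.3·10⁶ > 32.1⁴ > c₀(1/16)⁴ = 1.05·10⁶`. Engine 1 (python `engines-g8/surface_rowsum.py`): untruncated value
  2.00·10⁸ (ratio 190 to the printed count); the failure sets in at L ≥ 8 (d = 4) and L ≥ 16 (d = 3) at αδ₀ = 1/8 and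
  never in d = 2 (ratio ≤ 0.67 for L ≤ 64). Geometric realisability of the witness (existence of the 31⁶ distinct
  admissible endpoints with these path lengths) is the HYPOTHESIS pair `hinj`/`hpath` of `surfaceWitness_le_sum`,
  validated in prose above — as in `B6Lemma21Counterexample.witnessSum_le_sum`.
* ARITHMETIC of the corrected geometric bound (2.58″)
    Σ_{j′} Σ_{m ≥ max(|j−j′|−1,0)} e^{−½αδ₀(m−1)⁺RM} c₀(½α)^{d(3m+1)}
  ((m−1)⁺ = the G-A11-1 repair; 3m+1 = one single-scale leg + m surface legs (2d each) + m single-scale legs):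
  `inner_sum_twoScale_le`, `ineq258TwoScale_sum_le` — under the SAME (2.59) (which gives e^{−½αδ₀RM}c₀^{3d} ≤ e^{−2}c₀^{−d}
  ≤ e^{−1}) the sum is ≤ 3c + 9.75c⁴ ≤ 13c⁴ = `c1TwoScale` := 13 c₀(½α)^{4d}; `c1Repaired_le_c1TwoScale`.
  (Engine 1: with the sharper q ≤ e^{−2} the constant is 3c + 6.145c⁴ ≤ 10c⁴; 13 is kept for a verbatim reuse of the
  gen-7 arithmetic.)
* `Lemma21TwoScale`: Lemma 2.1 verbatim with c₁ ↦ c₁″; `lemma21TwoScale_of_ineq261T` (from kernel (2.60) + the row-sum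
  leaf (2.61″)); `lemma21Repaired_imp_twoScale`, `lemma21TwoScale_full`.
WHAT IS NOT REPRODUCED: the bridge from the geometry (contour decomposition (2.47), (2.57) for l ≤ m−1, the injectivity
of the two-scale displacement map on each leg) to the hypotheses of the counting lemma, i.e. (2.61″) itself; the
consumers of Lemma 2.1 (B6 Props 2.2–2.8, B9 p. 393, B11 (190)) use c₁ only as an α-dependent O(1) constant, so
c₁ ↦ c₁″ changes no downstream statement (`Ineq261With` is monotone in the constant).
-/

namespace Literature.MathematicalPhysics.QuantumFieldTheory.Balaban1983to89.B6Lemma21TwoScale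

open Literature.MathematicalPhysics.QuantumFieldTheory.Balaban1983to89
open Finset

/-! ## 1. The counting lemma -/
/-- ℓ¹-size of a lattice vector `p : Fin n → ℤ`. [folklore] -/
def l1 {ι : Type*} [Fintype ι] (p : ι → ℤ) : ℕ := ∑ i, (p i).natAbs

/-- `e^{−a|p|₁} = Π_i e^{−a|p_i|}`. [folklore] -/
theorem exp_neg_l1 {ι : Type*} [Fintype ι] (a : ℝ) (p : ι → ℤ) :
    Real.exp (-(a * (l1 p : ℝ))) = ∏ i, Real.exp (-(a * |((p i : ℤ) : ℝ)|)) := by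
  rw [← Real.exp_sum]
  congr 1
  simp only [l1, Nat.cast_sum, Finset.mul_sum, Finset.sum_neg_distrib]
  congr 1
  refine Finset.sum_congr rfl fun i _ => ?_
  rw [Nat.cast_natAbs, Int.cast_abs]

/-- A finite truncation of c₀ is ≤ c₀. [folklore] -/
theorem sum_Icc_exp_le_c0 {δ₀ α : ℝ} (h : 0 < α * δ₀) (N : ℕ) :
    ∑ z ∈ Finset.Icc (-(N : ℤ)) N, Real.exp (-(α * δ₀ * |(z : ℝ)|)) ≤ B6.c0 δ₀ α :=
  Summable.sum_le_tsum _ (fun _ _ => (Real.exp_pos _).le) (B6Lemma21Arith.summable_c0_term h)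

/-- **Counting lemma.** If a finite set `S` of points is mapped INJECTIVELY into `ℤ^n` by `ρ` and the weight `w x`
dominates the ℓ¹-size of `ρ x`, then `Σ_{x∈S} e^{−αδ₀ w x} ≤ c₀(δ₀,α)^n`. This is the ONLY counting principle the
proof of (2.58) uses; the paper applies it with n = d to every intermediate point. [cite: Balaban1984PropagatorsII,
(2.58) p.233 (the count «(c₀(½α))^{d(2m+1)}»)] [folklore] -/
theorem sum_exp_le_c0_pow {X : Type*} [DecidableEq X] {δ₀ α : ℝ} (h : 0 < α * δ₀)
    {ι : Type*} [Fintype ι] [DecidableEq ι] (S : Finset X)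
    (ρ : X → (ι → ℤ)) (hinj : Set.InjOn ρ S) (w : X → ℝ) (hw : ∀ x ∈ S, (l1 (ρ x) : ℝ) ≤ w x) :
    ∑ x ∈ S, Real.exp (-(α * δ₀ * w x)) ≤ B6.c0 δ₀ α ^ Fintype.card ι := by
  classical
  -- a common box containing the image
  set N : ℕ := S.sup fun x => l1 (ρ x) with hN
  have hbox : ∀ x ∈ S, ρ x ∈ Fintype.piFinset fun _ : ι => Finset.Icc (-(N : ℤ)) N := by
    intro x hx
    rw [Fintype.mem_piFinset]
    intro i
    have h1 : (ρ x i).natAbs ≤ l1 (ρ x) := by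
      unfold l1
      exact Finset.single_le_sum (f := fun i => (ρ x i).natAbs) (fun _ _ => Nat.zero_le _) (Finset.mem_univ i)
    have h2 : l1 (ρ x) ≤ N := Finset.le_sup (f := fun x => l1 (ρ x)) hx
    rw [Finset.mem_Icc]
    omega
  calc ∑ x ∈ S, Real.exp (-(α * δ₀ * w x))
      ≤ ∑ x ∈ S, Real.exp (-(α * δ₀ * (l1 (ρ x) : ℝ))) := by
        apply Finset.sum_le_sum
        intro x hx
        apply Real.exp_le_exp.2
        have := hw x hx
        nlinarith
    _ = ∑ p ∈ S.image ρ, Real.exp (-(α * δ₀ * (l1 p : ℝ))) := by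
        rw [Finset.sum_image hinj]
    _ ≤ ∑ p ∈ Fintype.piFinset (fun _ : ι => Finset.Icc (-(N : ℤ)) N),
          Real.exp (-(α * δ₀ * (l1 p : ℝ))) := by
        apply Finset.sum_le_sum_of_subset_of_nonneg
        · intro p hp
          obtain ⟨x, hx, rfl⟩ := Finset.mem_image.1 hp
          exact hbox x hx
        · intros; exact (Real.exp_pos _).le
    _ = ∑ p ∈ Fintype.piFinset (fun _ : ι => Finset.Icc (-(N : ℤ)) N),
          ∏ i, Real.exp (-(α * δ₀ * |((p i : ℤ) : ℝ)|)) := by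
        refine Finset.sum_congr rfl fun p _ => exp_neg_l1 _ p
    _ = ∏ _i : ι, ∑ z ∈ Finset.Icc (-(N : ℤ)) N, Real.exp (-(α * δ₀ * |(z : ℝ)|)) := by
        rw [Finset.prod_univ_sum]
    _ ≤ ∏ _i : ι, B6.c0 δ₀ α := by
        apply Finset.prod_le_prod
        · intros; exact Finset.sum_nonneg fun _ _ => (Real.exp_pos _).le
        · intros; exact sum_Icc_exp_le_c0 h N
    _ = B6.c0 δ₀ α ^ Fintype.card ι := by simp

/-- Single-scale legs (y → y₁, y′_l → y_{l+1}: bonds of ONE lattice Λ_j): displacement = one ℤ^d vector, count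
`c₀^d` — the printed per-point count is CORRECT for these legs. [cite: Balaban1984PropagatorsII, (2.47) p.231, (2.58) p.233] -/
theorem singleScale_row_sum {X : Type*} [DecidableEq X] {δ₀ α : ℝ} (h : 0 < α * δ₀) {d : ℕ} (S : Finset X)
    (ρ : X → (Fin d → ℤ)) (hinj : Set.InjOn ρ S) (w : X → ℝ) (hw : ∀ x ∈ S, (l1 (ρ x) : ℝ) ≤ w x) :
    ∑ x ∈ S, Real.exp (-(α * δ₀ * w x)) ≤ B6.c0 δ₀ α ^ d := by
  simpa using sum_exp_le_c0_pow h S ρ hinj w hw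

/-- Surface legs (y_l → y′_l: coarse AND fine sub-portions, p. 231): displacement = a coarse ℤ^d vector `c` PLUS a fine
ℤ^d vector `f`, weight ≥ |c|₁ + |f|₁, count `c₀^{2d}` — the CORRECT per-surface-point count replacing the printed
`c₀^d`. [cite: Balaban1984PropagatorsII, p.231 ll. 20–27, (2.58) p.233; corrected] -/
theorem twoScale_row_sum {X : Type*} [DecidableEq X] {δ₀ α : ℝ} (h : 0 < α * δ₀) {d : ℕ} (S : Finset X)
    (c f : X → (Fin d → ℤ)) (hinj : Set.InjOn (fun x => (c x, f x)) S) (w : X → ℝ)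
    (hw : ∀ x ∈ S, ((l1 (c x) : ℝ) + l1 (f x)) ≤ w x) :
    ∑ x ∈ S, Real.exp (-(α * δ₀ * w x)) ≤ B6.c0 δ₀ α ^ (2 * d) := by
  classical
  let ρ : X → (Fin d ⊕ Fin d → ℤ) := fun x => Sum.elim (c x) (f x)
  have hl1 : ∀ x, l1 (ρ x) = l1 (c x) + l1 (f x) := by
    intro x
    simp [l1, ρ, Fintype.sum_sum_type]
  have hinj' : Set.InjOn ρ S := by
    intro x hx y hy hxy
    apply hinj hx hy
    simp only [Prod.mk.injEq]
    constructor
    · funext i; exact congrFun hxy (Sum.inl i)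
    · funext i; exact congrFun hxy (Sum.inr i)
  have := sum_exp_le_c0_pow h S ρ hinj' w fun x hx => by rw [hl1]; push_cast; exact hw x hx
  simpa [Fintype.card_sum, two_mul] using this

/-! ## 2. Witness: the printed per-surface-point count `c₀(½α)^d` is exceeded (d = 4, rate 1/16, L ≥ 32) -/
/-- The box `[−15,15]³ ⊂ ℤ³` (offsets inside a flat face of Σ_j; the coarse and the fine offsets each range over it). [folklore] -/
noncomputable def box3 : Finset (Fin 3 → ℤ) := Fintype.piFinset fun _ => Finset.Icc (-15 : ℤ) 15

/-- The sum over the box factorises. [folklore] -/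
theorem sum_box3 (a : ℝ) :
    ∑ p ∈ box3, Real.exp (-(a * (l1 p : ℝ)))
      = (∑ z ∈ Finset.Icc (-15 : ℤ) 15, Real.exp (-(a * |(z : ℝ)|))) ^ 3 := by
  unfold box3
  rw [show ((∑ z ∈ Finset.Icc (-15 : ℤ) 15, Real.exp (-(a * |(z : ℝ)|))) ^ 3
      = ∏ _i : Fin 3, ∑ z ∈ Finset.Icc (-15 : ℤ) 15, Real.exp (-(a * |(z : ℝ)|))) by simp]
  rw [Finset.prod_univ_sum]
  exact Finset.sum_congr rfl fun p _ => exp_neg_l1 a p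

/-- The surface-leg witness family: pairs `(c, f)` of coarse / fine offsets in `[−15,15]³`, weight
`|c|₁ + |f|₁ + 4`. [cite: Balaban1984PropagatorsII, p.231 ll. 20–27 (two-scale legs), (2.58) p.233] -/
noncomputable def surfaceWitness (a : ℝ) : ℝ :=
  ∑ p ∈ box3 ×ˢ box3, Real.exp (-(a * ((l1 p.1 : ℝ) + l1 p.2 + 4)))

/-- `surfaceWitness a = e^{−4a}·(Σ_{|z|≤15} e^{−a|z|})⁶`. [folklore] -/
theorem surfaceWitness_eq (a : ℝ) :
    surfaceWitness a = Real.exp (-(4 * a))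
      * (∑ z ∈ Finset.Icc (-15 : ℤ) 15, Real.exp (-(a * |(z : ℝ)|))) ^ 6 := by
  unfold surfaceWitness
  rw [Finset.sum_product]
  have : ∀ p q : Fin 3 → ℤ, Real.exp (-(a * ((l1 p : ℝ) + l1 q + 4)))
      = Real.exp (-(4 * a)) * (Real.exp (-(a * (l1 p : ℝ))) * Real.exp (-(a * (l1 q : ℝ)))) := by
    intro p q; rw [← Real.exp_add, ← Real.exp_add]; congr 1; ring
  simp_rw [this, ← Finset.mul_sum, ← Finset.sum_mul, sum_box3]
  ring

/-- **Witness lower bound (abstract):** if the `31⁶` points `site (c,f)` are distinct and reachable at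
distance `≤ |c|₁ + |f|₁ + 4` from `y`, the row sum at rate `a` dominates `surfaceWitness a`. [folklore] -/
theorem surfaceWitness_le_sum {S : Type*} [Fintype S] [DecidableEq S]
    (dist : S → S → ℝ) (y : S) (a : ℝ) (ha : 0 ≤ a)
    (site : (Fin 3 → ℤ) × (Fin 3 → ℤ) → S) (hinj : Set.InjOn site ↑(box3 ×ˢ box3))
    (hpath : ∀ p ∈ box3 ×ˢ box3, dist y (site p) ≤ (l1 p.1 : ℝ) + l1 p.2 + 4) :
    surfaceWitness a ≤ ∑ y' : S, Real.exp (-(a * dist y y')) :=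
  B6Lemma21Counterexample.sum_exp_ge_of_paths dist y a ha (box3 ×ˢ box3) site hinj _ hpath

/-- **Numerics at rate a = αδ₀ = 1/16** (the paper's c₀(½α) with ½αδ₀ = 1/16, i.e. αδ₀ = 1/8 as in
`B6Lemma21Counterexample`): `c₀^4 < surfaceWitness` — the printed per-point count `c₀(½α)^d`, d = 4, is exceeded by the
surface row sum by a factor ≥ 2.2 (kernel; ≥ 190 untruncated, engine). [cite: Balaban1984PropagatorsII, (2.58) p.233;
refuted as a per-point count] -/
theorem surfaceWitness_gt (δ₀ α : ℝ) (h : α * δ₀ = 1 / 16) :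
    B6.c0 δ₀ α ^ 4 < surfaceWitness (α * δ₀) := by
  rw [h, surfaceWitness_eq, B6Lemma21Counterexample.c0_closed (by rw [h]; norm_num), h]
  obtain ⟨hp1, hp2⟩ := B6Lemma21Counterexample.p_bounds
  set p := Real.exp (-(1 / 16 : ℝ)) with hp
  have hp0 : 0 < p := Real.exp_pos _
  -- e^{−4/16} = p⁴
  have h4 : Real.exp (-(4 * (1 / 16 : ℝ))) = p ^ 4 := by
    rw [hp, ← Real.exp_nat_mul]; congr 1; norm_num
  -- each term of the truncated sum is ≥ p^15
  have hterm : ∀ z ∈ Finset.Icc (-15 : ℤ) 15, p ^ 15 ≤ Real.exp (-((1 / 16 : ℝ) * |(z : ℝ)|)) := by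
    intro z hz
    rw [Finset.mem_Icc] at hz
    have hz' : |(z : ℝ)| ≤ 15 := by
      rw [abs_le]; constructor <;> exact_mod_cast (by omega : _)
    calc p ^ 15 = Real.exp (-(15 / 16 : ℝ)) := by
          rw [hp, ← Real.exp_nat_mul]; congr 1; norm_num
      _ ≤ Real.exp (-((1 / 16 : ℝ) * |(z : ℝ)|)) := by
          apply Real.exp_le_exp.2; linarith
  have hT : 31 * p ^ 15 ≤ ∑ z ∈ Finset.Icc (-15 : ℤ) 15, Real.exp (-((1 / 16 : ℝ) * |(z : ℝ)|)) := by
    have := Finset.sum_le_sum hterm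
    simpa using this
  have hp15 : (0.39 : ℝ) ≤ p ^ 15 := by
    calc (0.39 : ℝ) ≤ 0.9394 ^ 15 := by norm_num
      _ ≤ p ^ 15 := pow_le_pow_left₀ (by norm_num) hp1.le _
  have hp4 : (0.77 : ℝ) ≤ p ^ 4 := by
    calc (0.77 : ℝ) ≤ 0.9394 ^ 4 := by norm_num
      _ ≤ p ^ 4 := pow_le_pow_left₀ (by norm_num) hp1.le _
  have hT' : (12 : ℝ) ≤ ∑ z ∈ Finset.Icc (-15 : ℤ) 15, Real.exp (-((1 / 16 : ℝ) * |(z : ℝ)|)) := by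
    nlinarith
  have hc0 : (1 + p) / (1 - p) < 32.1 := by
    rw [div_lt_iff₀ (by linarith)]; nlinarith
  have hc0pos : 0 < (1 + p) / (1 - p) := div_pos (by linarith) (by linarith)
  have hL : ((1 + p) / (1 - p)) ^ 4 < 32.1 ^ 4 := pow_lt_pow_left₀ hc0 hc0pos.le (by norm_num)
  have hR : (0.77 : ℝ) * 12 ^ 6 ≤ p ^ 4 * (∑ z ∈ Finset.Icc (-15 : ℤ) 15,
      Real.exp (-((1 / 16 : ℝ) * |(z : ℝ)|))) ^ 6 :=
    mul_le_mul hp4 (pow_le_pow_left₀ (by norm_num) hT' _) (by norm_num) (by positivity)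
  rw [h4]
  have : (32.1 : ℝ) ^ 4 < 0.77 * 12 ^ 6 := by norm_num
  linarith

/-! ## 3. Arithmetic of the corrected bound (2.58″): `c₀^{d(3m+1)}` per `m` -/
/-- The two-scale constant `c₁″(α) := 13 c₀(½α)^{4d}` (replaces c₁′ = 13c₀^{3d} of `B6Lemma21Arith`, itself the repair of
the printed 12c₀^d). [cite: Balaban1984PropagatorsII, Lemma 2.1 p.234 (c₁(α)); repaired] -/
noncomputable def c1TwoScale (d : ℕ) (δ₀ α : ℝ) : ℝ := 13 * B6.c0 δ₀ (α / 2) ^ (4 * d)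

/-- Inner m-sum of (2.58″): for `1 ≤ c`, `A > 4 log c + 2` ((2.59)), `Σ_{m≥m₀} e^{−A(m−1)⁺} c^{3m+1} ≤ [m₀=0]c +
c⁴e^{−(m₀−1)⁺}/(1−e^{−1})` (q = e^{−A}c³ ≤ e^{−2}c^{−1} ≤ e^{−1}). [cite: Balaban1984PropagatorsII, (2.58)–(2.59) p.233; corrected] -/
theorem inner_sum_twoScale_le {A c : ℝ} (hc : 1 ≤ c) (hA : 4 * Real.log c + 2 < A) (m₀ : ℕ) :
    ∑' m : ℕ, Real.exp (-(A * ((m₀ + m - 1 : ℕ) : ℝ))) * c ^ (3 * (m₀ + m) + 1)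
      ≤ (if m₀ = 0 then c else 0)
        + c ^ 4 * Real.exp (-((m₀ - 1 : ℕ) : ℝ)) / (1 - Real.exp (-1)) := by
  have hcpos : 0 < c := by linarith
  have hlogc : 0 ≤ Real.log c := Real.log_nonneg hc
  set q : ℝ := Real.exp (-A) * c ^ 3 with hq
  have hqpos : 0 < q := by positivity
  have hq1 : q ≤ Real.exp (-1) := by
    have hlogq : Real.log q = -A + 3 * Real.log c := by
      rw [hq, Real.log_mul (Real.exp_pos _).ne' (by positivity), Real.log_exp, Real.log_pow]
      push_cast; ring
    calc q = Real.exp (Real.log q) := (Real.exp_log hqpos).symm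
      _ ≤ Real.exp (-1) := by
          apply Real.exp_le_exp.2
          rw [hlogq]; linarith
  have he1 : Real.exp (-1) < 1 := by rw [Real.exp_lt_one_iff]; norm_num
  have hqlt : q < 1 := lt_of_le_of_lt hq1 he1
  have hden : 0 < 1 - Real.exp (-1) := by linarith
  have hden' : (1 - q)⁻¹ ≤ (1 - Real.exp (-1))⁻¹ := inv_anti₀ (by linarith) (by linarith)
  have h1q : 0 ≤ (1 - q)⁻¹ := inv_nonneg.2 (by linarith)
  have hterm : ∀ n : ℕ, 1 ≤ n →
      Real.exp (-(A * ((n - 1 : ℕ) : ℝ))) * c ^ (3 * n + 1) = c ^ 4 * q ^ (n - 1) := by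
    intro n hn
    obtain ⟨k, rfl⟩ : ∃ k, n = k + 1 := ⟨n - 1, by omega⟩
    have h1 : Real.exp (-(A * ((k + 1 - 1 : ℕ) : ℝ))) = Real.exp (-A) ^ k := by
      rw [← Real.exp_nat_mul]; congr 1; simp only [Nat.add_sub_cancel]; ring
    rw [h1, hq, Nat.add_sub_cancel, mul_pow, ← pow_mul]
    have : 3 * (k + 1) + 1 = 3 * k + 4 := by ring
    rw [this, pow_add]; ring
  rcases Nat.eq_zero_or_pos m₀ with h0 | hpos
  · subst h0
    simp only [zero_add, Nat.zero_sub, if_true, Nat.cast_zero, neg_zero, Real.exp_zero, mul_one]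
    have hf : (fun m : ℕ => Real.exp (-(A * ((m - 1 : ℕ) : ℝ))) * c ^ (3 * m + 1))
        = fun m : ℕ => if m = 0 then c else c ^ 4 * q ^ (m - 1) := by
      funext m
      rcases Nat.eq_zero_or_pos m with hm | hm
      · subst hm; simp
      · rw [if_neg (by omega), hterm m hm]
    rw [hf]
    have hshift : (fun m : ℕ => if m + 1 = 0 then c else c ^ 4 * q ^ (m + 1 - 1))
        = fun m : ℕ => c ^ 4 * q ^ m := by
      funext m; simp
    have hsum_shift : Summable fun m : ℕ => if m + 1 = 0 then c else c ^ 4 * q ^ (m + 1 - 1) := by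
      rw [hshift]; exact (summable_geometric_of_lt_one hqpos.le hqlt).mul_left _
    have hsum : Summable fun m : ℕ => if m = 0 then c else c ^ 4 * q ^ (m - 1) :=
      (summable_nat_add_iff 1).1 hsum_shift
    rw [hsum.tsum_eq_zero_add]
    simp only [if_true, hshift]
    rw [tsum_mul_left, tsum_geometric_of_lt_one hqpos.le hqlt]
    have : c ^ 4 * (1 - q)⁻¹ ≤ c ^ 4 / (1 - Real.exp (-1)) := by
      rw [div_eq_mul_inv]; exact mul_le_mul_of_nonneg_left hden' (by positivity)
    linarith
  · rw [if_neg (by omega)]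
    have hf : (fun m : ℕ => Real.exp (-(A * ((m₀ + m - 1 : ℕ) : ℝ))) * c ^ (3 * (m₀ + m) + 1))
        = fun m : ℕ => c ^ 4 * q ^ (m₀ - 1) * q ^ m := by
      funext m
      rw [hterm (m₀ + m) (by omega)]
      have : m₀ + m - 1 = (m₀ - 1) + m := by omega
      rw [this, pow_add, mul_assoc]
    rw [hf, tsum_mul_left, tsum_geometric_of_lt_one hqpos.le hqlt]
    have hqm : q ^ (m₀ - 1) ≤ Real.exp (-((m₀ - 1 : ℕ) : ℝ)) := by
      calc q ^ (m₀ - 1) ≤ Real.exp (-1) ^ (m₀ - 1) := pow_le_pow_left₀ hqpos.le hq1 _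
        _ = Real.exp (-((m₀ - 1 : ℕ) : ℝ)) := by rw [← Real.exp_nat_mul]; congr 1; ring
    have : c ^ 4 * q ^ (m₀ - 1) * (1 - q)⁻¹
        ≤ c ^ 4 * Real.exp (-((m₀ - 1 : ℕ) : ℝ)) * (1 - Real.exp (-1))⁻¹ := by
      apply mul_le_mul (mul_le_mul_of_nonneg_left hqm (by positivity)) hden' h1q (by positivity)
    rw [div_eq_mul_inv]; linarith

/-- **(2.58″) ⇒ (2.61″), kernel engine.** Under (2.59), `Σ_{j′∈ℤ}Σ_m e^{−½αδ₀RM(m−1)⁺} c^{3m+1} ≤ 3c + 9.75c⁴ ≤ 13c⁴ =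
`c1TwoScale`, c = c₀(½α)^d. [cite: Balaban1984PropagatorsII, (2.58)–(2.61) pp.233–234; corrected] -/
theorem ineq258TwoScale_sum_le {d : ℕ} {δ₀ α R M : ℝ} (hα : 0 < α) (hδ : 0 < δ₀)
    (h259 : B6.Cond259 d δ₀ α R M) (j : ℤ) :
    ∑' j' : ℤ, ∑' m : ℕ,
        Real.exp (-((1 / 2) * α * δ₀ * R * M * ((B6Lemma21Arith.m0 (j - j') + m - 1 : ℕ) : ℝ)))
          * (B6.c0 δ₀ (α / 2) ^ d) ^ (3 * (B6Lemma21Arith.m0 (j - j') + m) + 1)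
      ≤ c1TwoScale d δ₀ α := by
  have hc0 : 1 ≤ B6.c0 δ₀ (α / 2) := B6Lemma21Arith.one_le_c0 (by positivity)
  have hc : 1 ≤ B6.c0 δ₀ (α / 2) ^ d := one_le_pow₀ hc0
  set c := B6.c0 δ₀ (α / 2) ^ d with hcdef
  have hA := (B6Lemma21Arith.cond259_iff_A (d := d) (R := R) (M := M)).1 h259
  rw [← hcdef] at hA
  set A := (1 / 2) * α * δ₀ * R * M
  have hr : Real.exp (-1) < 1 := by rw [Real.exp_lt_one_iff]; norm_num
  have hden : 0 < 1 - Real.exp (-1) := by linarith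
  have hm0_sub : ∀ z : ℤ, B6Lemma21Arith.m0 z - 1 = (|z| - 2).toNat := by
    intro z; unfold B6Lemma21Arith.m0; omega
  have hm0_zero : ∀ z : ℤ, (B6Lemma21Arith.m0 z = 0 ↔ |z| ≤ 1) := by
    intro z; unfold B6Lemma21Arith.m0; omega
  let K : ℝ := c ^ 4 / (1 - Real.exp (-1))
  let g : ℤ → ℝ := fun z => (if |z| ≤ 1 then c else 0)
    + K * Real.exp (-(((|z| - 2).toNat : ℕ) : ℝ))
  have hinner : ∀ j' : ℤ,
      ∑' m : ℕ, Real.exp (-(A * ((B6Lemma21Arith.m0 (j - j') + m - 1 : ℕ) : ℝ)))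
          * c ^ (3 * (B6Lemma21Arith.m0 (j - j') + m) + 1)
        ≤ g (j - j') := by
    intro j'
    calc _ ≤ (if B6Lemma21Arith.m0 (j - j') = 0 then c else 0)
          + c ^ 4 * Real.exp (-((B6Lemma21Arith.m0 (j - j') - 1 : ℕ) : ℝ)) / (1 - Real.exp (-1)) :=
          inner_sum_twoScale_le hc hA _
      _ = g (j - j') := by
          simp only [g, K, hm0_sub, hm0_zero]
          ring
  have hnn : ∀ j' : ℤ, 0 ≤ ∑' m : ℕ,
      Real.exp (-(A * ((B6Lemma21Arith.m0 (j - j') + m - 1 : ℕ) : ℝ)))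
        * c ^ (3 * (B6Lemma21Arith.m0 (j - j') + m) + 1) :=
    fun j' => tsum_nonneg fun m => by positivity
  have hind_sum : Summable fun z : ℤ => (if |z| ≤ 1 then c else (0 : ℝ)) := by
    apply summable_of_ne_finset_zero (s := ({-1, 0, 1} : Finset ℤ))
    intro z hz
    rw [if_neg]
    intro h
    apply hz
    simp only [Finset.mem_insert, Finset.mem_singleton]
    have h' := abs_le.1 h
    omega
  have hind_val : ∑' z : ℤ, (if |z| ≤ 1 then c else (0 : ℝ)) = 3 * c := by
    rw [tsum_eq_sum (s := ({-1, 0, 1} : Finset ℤ))]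
    · rw [Finset.sum_insert (by decide), Finset.sum_insert (by decide), Finset.sum_singleton]
      simp; ring
    · intro z hz
      rw [if_neg]
      intro h
      apply hz
      simp only [Finset.mem_insert, Finset.mem_singleton]
      have h' := abs_le.1 h
      omega
  have hexp_sum : Summable fun z : ℤ => Real.exp (-(((|z| - 2).toNat : ℕ) : ℝ)) := by
    apply Summable.of_nonneg_of_le (fun z => (Real.exp_pos _).le)
      (fun z => ?_) (B6Lemma21Arith.summable_int_exp_neg_abs.mul_left (Real.exp 2))
    rw [← Real.exp_add, Real.exp_le_exp]
    have : ((|z| - 2 : ℤ) : ℝ) ≤ (((|z| - 2).toNat : ℕ) : ℝ) := by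
      exact_mod_cast Int.self_le_toNat (|z| - 2)
    push_cast at this
    linarith
  have hmaj : Summable g := hind_sum.add (hexp_sum.mul_left K)
  have hmaj' : Summable fun j' : ℤ => g (j - j') :=
    ((Equiv.subLeft j).summable_iff (f := g)).2 hmaj
  have hsum := Summable.of_nonneg_of_le hnn hinner hmaj'
  calc _ ≤ ∑' j' : ℤ, g (j - j') := hsum.tsum_le_tsum hinner hmaj'
    _ = ∑' z : ℤ, g z := (Equiv.subLeft j).tsum_eq g
    _ = 3 * c + K * (3 + 2 * (1 - Real.exp (-1))⁻¹) := by
        simp only [g]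
        rw [Summable.tsum_add hind_sum (hexp_sum.mul_left K), hind_val, tsum_mul_left,
          B6Lemma21Arith.tsum_int_exp_neg_abs_sub_two]
    _ = c * 3 + c ^ 4 * ((3 + 2 * (1 - Real.exp (-1))⁻¹) * (1 - Real.exp (-1))⁻¹) := by
        simp only [K]; ring
    _ ≤ c ^ 4 * 3 + c ^ 4 * ((3 + 2 * (1 - Real.exp (-1))⁻¹) * (1 - Real.exp (-1))⁻¹) := by
        have : c ≤ c ^ 4 := by
          calc c = c ^ 1 := (pow_one c).symm
            _ ≤ c ^ 4 := pow_le_pow_right₀ hc (by norm_num)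
        nlinarith
    _ = c ^ 4 * (3 + (3 + 2 * (1 - Real.exp (-1))⁻¹) * (1 - Real.exp (-1))⁻¹) := by ring
    _ ≤ c ^ 4 * 13 :=
        mul_le_mul_of_nonneg_left B6Lemma21Arith.repaired_constant_le_thirteen (by positivity)
    _ = c1TwoScale d δ₀ α := by rw [c1TwoScale, hcdef, ← pow_mul]; ring

/-- `13c₀^{3d} ≤ 13c₀^{4d}`: every consumer bound with c₁′ (a fortiori with the printed c₁) holds with c₁″. [folklore] -/
theorem c1Repaired_le_c1TwoScale {d : ℕ} {δ₀ α : ℝ} (hα : 0 < α) (hδ : 0 < δ₀) :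
    B6Lemma21Arith.c1Repaired d δ₀ α ≤ c1TwoScale d δ₀ α := by
  have hc0 : 1 ≤ B6.c0 δ₀ (α / 2) := B6Lemma21Arith.one_le_c0 (by positivity)
  unfold B6Lemma21Arith.c1Repaired c1TwoScale
  have h1 : B6.c0 δ₀ (α / 2) ^ (3 * d) ≤ B6.c0 δ₀ (α / 2) ^ (4 * d) :=
    pow_le_pow_right₀ hc0 (by omega)
  linarith

/-! ## 4. Lemma 2.1 with the two-scale constant -/

/-- **Lemma 2.1, TWO-SCALE constant** (p. 234 with c₁(α) = 12c₀^d(½α) replaced by c₁″(α) = 13c₀^{4d}(½α); everything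
else as in `B6.Lemma21Printed`: the section hypotheses (2.1)–(2.2), 0 < α < 1, (2.59) ⇒ (2.60) ∧ (2.61″)). This is the
statement supported by the print argument once BOTH located defects are repaired: the spurious factor at l = m
(G-A11-1) and the single-scale per-point count on the surface legs (G-A13-1). [cite: Balaban1984PropagatorsII,
Lemma 2.1 (2.60)–(2.61) p.234; repaired] -/
def Lemma21TwoScale {I : Type} (d : ℕ) (δ₀ : ℝ) (geo : I → B6.Geometry) : Prop :=
  ∀ i : I, (geo i).Hyp21_22 → ∀ α : ℝ, 0 < α → α < 1 → B6.Cond259 d δ₀ α (geo i).R (geo i).M →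
    B6RandomWalk.Ineq260 (geo i) δ₀ α ∧ B6Lemma21Repaired.Ineq261With (c1TwoScale d δ₀ α) (geo i) δ₀ α

/-- Direction of the constants: the gen-7 repaired statement implies the two-scale one (c₁′ ≤ c₁″). [folklore] -/
theorem lemma21Repaired_imp_twoScale {I : Type} (d : ℕ) (δ₀ : ℝ) (hδ : 0 < δ₀) (geo : I → B6.Geometry)
    (h : B6Lemma21Repaired.Lemma21Repaired d δ₀ geo) : Lemma21TwoScale d δ₀ geo := by
  intro i hH α hα0 hα1 hcond
  obtain ⟨h260, h261⟩ := h i hH α hα0 hα1 hcond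
  exact ⟨h260, B6Lemma21Repaired.ineq261With_mono (c1Repaired_le_c1TwoScale hα0 hδ) h261⟩

/-- **The two-scale Lemma 2.1 from (2.61″) alone**: (2.60) kernel (`B6Geometry.ineq260_of_levelGap`), the row-sum
bound (2.61″) with c₁″ the ONLY analytic leaf. [cite: Balaban1984PropagatorsII, Lemma 2.1 p.234; repaired] -/
theorem lemma21TwoScale_of_ineq261T {I : Type} (d : ℕ) (δ₀ : ℝ) (hδ : 0 ≤ δ₀) (geo : I → B6.Geometry)
    (C : ∀ i, B6Geometry.ContourSystem (geo i)) (N : I → ℕ)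
    (hreal : ∀ i, B6Geometry.Realizes (geo i) (C i)) (hconn : ∀ i, (C i).bond.Connected)
    (hgap : ∀ i, B6Geometry.LevelGap (C i).bond (C i).zone (N i))
    (hRM : ∀ i, (geo i).R * (geo i).M ≤ N i)
    (h261T : ∀ i : I, (geo i).Hyp21_22 → ∀ α : ℝ, 0 < α → α < 1 →
      B6.Cond259 d δ₀ α (geo i).R (geo i).M →
        B6Lemma21Repaired.Ineq261With (c1TwoScale d δ₀ α) (geo i) δ₀ α) :
    Lemma21TwoScale d δ₀ geo := by
  intro i hH α hα0 hα1 hcond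
  exact ⟨B6Geometry.ineq260_of_levelGap (hreal i) (hconn i) (hgap i) (hRM i) (mul_nonneg hα0.le hδ),
    h261T i hH α hα0 hα1 hcond⟩

/-- All four displays (2.60)–(2.63) with c₁″. [cite: Balaban1984PropagatorsII, Lemma 2.1 (2.60)–(2.63) p.234; repaired] -/
theorem lemma21TwoScale_full {I : Type} (d : ℕ) (δ₀ : ℝ) (hδ : 0 ≤ δ₀) (geo : I → B6.Geometry)
    (htri : ∀ i, B6RandomWalk.Triangle254 (geo i)) (h : Lemma21TwoScale d δ₀ geo) :
    ∀ i : I, (geo i).Hyp21_22 → ∀ α : ℝ, 0 < α → α < 1 → B6.Cond259 d δ₀ α (geo i).R (geo i).M →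
      B6RandomWalk.Ineq260 (geo i) δ₀ α ∧
        B6Lemma21Repaired.Ineq261With (c1TwoScale d δ₀ α) (geo i) δ₀ α ∧
        B6Lemma21Repaired.Ineq262With (c1TwoScale d δ₀ α) (geo i) δ₀ α ∧
        B6Lemma21Repaired.Ineq263With (c1TwoScale d δ₀ α) (geo i) δ₀ α := by
  intro i hH α hα0 hα1 hcond
  obtain ⟨h260, h261⟩ := h i hH α hα0 hα1 hcond
  exact ⟨h260, h261, B6Lemma21Repaired.ineq262With_of_261With h261,
    B6Lemma21Repaired.ineq263With_of_261With (htri i) hδ hα1.le h261⟩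

end Literature.MathematicalPhysics.QuantumFieldTheory.Balaban1983to89.B6Lemma21TwoScale
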